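/-
Copyright (c) 2026 the pub-hodgecm-mathlib formalisation cell (harness21).  Prover seat hodgecm-mathlib-K2E5-p17 (g9), Track B «K2-LIT»,
#184♮ = hLiu418 = `stmt-HodgeConjecture-24832`; socket #42S, organ S5, the small organ «`χʷ = χ`» for the character of record `χ = χ_b³·α̃`
(LEAD F0P6-plan (g14) BATCH #86 (1); K2Liu-audit1 (g2) box (A)(i) 2026-09-04T22:29:56Z).  THEOREMS ONLY; no `def`, no `instance`, no notation, no `sorry`.
-/
import Summits.HodgeConjecture.HodgeConjecture.Theorems.K2E1SelfDualHeckeCharactersFiniteCMTwo      -- ★ `reflectChar_eq_self_iff` (+ ★ `reflectChar`)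
import Literature.NumberTheory.GelbartRogawski1991.DoubledWeilRepresentationDetTwist                 -- ★ `ratioHecke`, `isSplittingChar_mul_ratioHecke_iff`, `Fp`
import Literature.RepresentationTheory.HarrisKudlaSweet1996.GlobalSplittingCharacters                -- ★ `IsSplittingChar`, `IsSplittingChar.pow`
import Literature.NumberTheory.Automorphic.QuadraticIdelicNormLocalNorms                              -- ★ `quadraticHeckeCharCM_ideleRelNorm` (`ε ∘ N_{L∕L⁺} = 1`)
import Literature.NumberTheory.Automorphic.UnitaryGroupAdelicOneTorus                                 -- ★ `ideleGalNorm_eq_mul_smul` (`N y = y·(c • y)`)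
import Literature.NumberTheory.Automorphic.AdeleGaloisDescent                                         -- ★ `AdeleRing.ideleBaseChange_ideleRelNorm`
import HarnessLib

/-!
# Crux `HLiu418`, socket #42S, organ S5 — the reflection parity `χʷ = χ` of a splitting character, and of the character of record `χ = χ_b³·α̃`

Cell `hodgecm-mathlib`, crux item hLiu418 = `stmt-HodgeConjecture-24832` (helper lane `--supports … --as helper`, count-neutral); squad K2 ∕ K2Liu,
LEAD F0P6-plan (g14) (BATCH #86 (1) «`Theorems/K2LiuReflectCharOfRecord.lean :: reflectChar_eq_self_of_record`»); prover K2E5-p17 (g9).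

WHY.  The constant term of the doubled Siegel Eisenstein series has its second summand in the induced space of the REFLECTED character
`χʷ := (χ ∘ (c ⊗ 1))⁻¹` (★ `K2E1CharacterEisensteinU2Defs.reflectChar`, `c` = complex conjugation of the CM field `L∕L⁺`); the (S5-c) letters of record
(★ `K2LiuConstantTermLettersOfOrgans.constantTerm_letters_of_organs` :80, ★ `K2LiuIncoherentConstantTermLetters` :132, ★ S5 ED. 4
`K2LiuIncoherentZeroResidueOfRecordEdFour` :215) carry the parity `hχw : reflectChar c χ = χ` BY VALUE.  For the character of record `χ = χ_b³·α̃`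
(`hχD : χb ^ 3 * ratioHecke L α hα hαrat = χ`, `χ_b` a splitting character `χ_b|_{𝕀_{L⁺}} = ε_{L∕L⁺}` (★ `IsSplittingChar L 1 χb`), `α̃(d) = α(d∕d̄)`) the parity
is automatic, and more generally for EVERY splitting character of any exponent `m`:
`χʷ = χ ⇔ ∀ a, χ(a)·χ(c • a) = 1` (★ `reflectChar_eq_self_iff`), and `a·(c • a) = (N_{L∕L⁺} a)_L` (★ `AdeleRing.ideleBaseChange_ideleRelNorm`, ★ `ideleGalNorm_eq_mul_smul`:
`Gal(L∕L⁺) = {1, c}`), on which a splitting character is `ε(N_{L∕L⁺} a)^m = 1` (★ `quadraticHeckeCharCM_ideleRelNorm`: `ε ∘ N = 1`).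
* §1 `reflectChar_eq_self_of_isSplittingChar` — `IsSplittingChar L m χ → χʷ = χ` (any `m`).
* §2 `isSplittingChar_three_of_record` — the character of record is a splitting character of exponent `3` (★ `isSplittingChar_mul_ratioHecke_iff`: `α̃|_{𝕀_{L⁺}} = 1`;
  ★ `IsSplittingChar.pow`); **`reflectChar_eq_self_of_record`** — `hχw` for the character of record, in the bytes of the (S5-c) letters.
References: [MoeglinWaldspurger1995] II.1.7 (the reflected character in the constant term); [GelbartRogawski1991] §3.1 (the twist `α̃`); [HarrisKudlaSweet1996] §1 (1.5)
(splitting characters); [CasselsFrohlichANT1967] Ch. VII §7 (idelic norm `N y = ∏_σ σ y`); [Omeara1963] §65A (ε kills norms).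
HONEST LABEL.  Count-neutral helper: `HC_CM` is proved only modulo the 7 printed citations (2 remaining named inputs: hLiu418 = `stmt-HodgeConjecture-24832`,
h413 = `stmt-HodgeConjecture-24833`) until rung 0 closes; this file closes no socket.
-/

set_option autoImplicit false
set_option linter.dupNamespace false -- the mandated namespace repeats `HodgeConjecture.HodgeConjecture`

noncomputable section

open NumberField
open Literature.NumberTheory.Automorphic Literature.NumberTheory.GaloisRepresentations
open Literature.RepresentationTheory.HarrisKudlaSweet1996
open Literature.NumberTheory.GelbartRogawski1991 Literature.NumberTheory.GelbartRogawski1991.GRConstruction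
open Literature.NumberTheory.GelbartRogawski1991.GRConstruction.DoubledWeilDetTwist
open Summit.HodgeConjecture.HodgeConjecture.Cruxes.H413.K2E1CharacterEisensteinU2Defs (reflectChar)
open Summit.HodgeConjecture.HodgeConjecture.Cruxes.H413.K2E1SelfDualHeckeCharactersFiniteCMTwo (reflectChar_eq_self_iff)

namespace Summit.HodgeConjecture.HodgeConjecture.Cruxes.HLiu418.K2LiuReflectCharOfRecord

variable (L : Type) [Field L] [NumberField L] [IsCMField L]

/-! ## §1 A splitting character is its own reflection -/

/-- **`a · (c • a) = (N_{L∕L⁺} a)_L` on idèles** of the CM field `L` (`c` = complex conjugation): the idelic norm followed by base change is the Galois norm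
`∏_σ σ • a` (★ `AdeleRing.ideleBaseChange_ideleRelNorm`), and `Gal(L∕L⁺) = {1, c}` (★ `ideleGalNorm_eq_mul_smul`; `[L : L⁺] = 2`, `c ≠ 1`).
[cite: CasselsFrohlichANT1967, Ch. VII §7.1, §7.3 (a)] -/
theorem mul_complexConj_smul_eq_ideleBaseChange_ideleRelNorm (a : ideleGroup L) :
    a * (IsCMField.complexConj L : L ≃ₐ[Fp L] L) • a =
      AdeleRing.ideleBaseChange (Fp L) L (AdeleRing.ideleRelNorm (Fp L) L a) := by
  rw [AdeleRing.ideleBaseChange_ideleRelNorm,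
    UnitaryGroup.ideleGalNorm_eq_mul_smul (Fp L) L (IsCMField.complexConj L) (Algebra.IsQuadraticExtension.finrank_eq_two (Fp L) L)
      (IsCMField.complexConj_ne_one L) a]

/-- **A SPLITTING CHARACTER IS ITS OWN REFLECTION**: if `χ|_{𝕀_{L⁺}} = ε_{L∕L⁺}^m` (★ `IsSplittingChar L m χ`, any `m`) then `χʷ = χ`, because
`χ(a)·χ(c • a) = χ((N a)_L) = ε(N a)^m = 1` (★ `quadraticHeckeCharCM_ideleRelNorm`) and ★ `reflectChar_eq_self_iff`.
[cite: MoeglinWaldspurger1995, II.1.7] [cite: HarrisKudlaSweet1996, §1 (1.5) p. 951] [cite: Omeara1963, §65A Example 65:2] -/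
theorem reflectChar_eq_self_of_isSplittingChar {m : ℕ} {χ : HeckeCharacter L} (hχ : IsSplittingChar L m χ) :
    reflectChar (IsCMField.complexConj L : L ≃ₐ[Fp L] L) χ = χ := by
  rw [reflectChar_eq_self_iff]
  intro a
  rw [← map_mul, mul_complexConj_smul_eq_ideleBaseChange_ideleRelNorm L a, hχ, quadraticHeckeCharCM_ideleRelNorm, one_pow]

/-! ## §2 The character of record `χ = χ_b³ · α̃` -/

/-- **THE CHARACTER OF RECORD IS A SPLITTING CHARACTER OF EXPONENT `3`**: `χ_b|_{𝕀_{L⁺}} = ε` gives `χ_b³|_{𝕀_{L⁺}} = ε³` (★ `IsSplittingChar.pow`), and the twist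
`α̃(d) = α(d∕d̄)` is trivial on `𝕀_{L⁺}` (★ `isSplittingChar_mul_ratioHecke_iff`). [cite: HarrisKudlaSweet1996, §1 (1.5) p. 951] [cite: GelbartRogawski1991, §3.1 Remark p. 457] -/
theorem isSplittingChar_three_of_record (χb : HeckeCharacter L) (hχbs : IsSplittingChar L 1 χb)
    (α : UnitaryGroup.adelicOne (Fp L) L (IsCMField.complexConj L) →* ℂˣ) (hα : Continuous α)
    (hαrat : ∀ u : UnitaryGroup.adelicOne (Fp L) L (IsCMField.complexConj L), (u : ideleGroup L) ∈ principalIdeles L → α u = 1)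
    {χ : HeckeCharacter L} (hχD : χb ^ 3 * ratioHecke L α hα hαrat = χ) :
    IsSplittingChar L 3 χ := by
  rw [← hχD, isSplittingChar_mul_ratioHecke_iff]
  simpa only [one_mul] using hχbs.pow 3

/-- **`hχw` FOR THE CHARACTER OF RECORD**: with the S5 record letters `(χb hχbs α hα hαrat hχD)` (`hχD : χb ^ 3 * ratioHecke L α hα hαrat = χ`,
`hχbs : IsSplittingChar L 1 χb`), the reflected character equals `χ`: `reflectChar c χ = χ` for `c` the complex conjugation of `L∕L⁺` — the by-value binder
`hχw` of ★ `constantTerm_letters_of_organs` ∕ ★ `K2LiuIncoherentConstantTermLetters` ∕ ★ S5 ED. 4, paid (§1 at `m = 3`, §2).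
[cite: MoeglinWaldspurger1995, II.1.7] [cite: GelbartRogawski1991, §3.1 Remark p. 457] [cite: HarrisKudlaSweet1996, §1 (1.5) p. 951] -/
theorem reflectChar_eq_self_of_record (χb : HeckeCharacter L) (hχbs : IsSplittingChar L 1 χb)
    (α : UnitaryGroup.adelicOne (Fp L) L (IsCMField.complexConj L) →* ℂˣ) (hα : Continuous α)
    (hαrat : ∀ u : UnitaryGroup.adelicOne (Fp L) L (IsCMField.complexConj L), (u : ideleGroup L) ∈ principalIdeles L → α u = 1)
    {χ : HeckeCharacter L} (hχD : χb ^ 3 * ratioHecke L α hα hαrat = χ) :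
    reflectChar (IsCMField.complexConj L : L ≃ₐ[Fp L] L) χ = χ :=
  reflectChar_eq_self_of_isSplittingChar L (isSplittingChar_three_of_record L χb hχbs α hα hαrat hχD)

end Summit.HodgeConjecture.HodgeConjecture.Cruxes.HLiu418.K2LiuReflectCharOfRecord

end
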